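import Summits.RiemannHypothesis.RiemannHypothesis.Theorems.UniversalFactorNarrowKernelNoGoEnvelopeStirling

/-!
# RiemannHypothesis / UniversalFactor — `NarrowKernelNoGo` (stmt-RiemannHypothesis-2576), line `Sketch`:
# stub P2, the ξ-envelope on the critical line against the weight `t^{-7/4} e^{πt/4}`

Second of the two files of the stub `UniversalFactor.stub_narrowEnvelope` (the first,
`UniversalFactorNarrowKernelNoGoEnvelopeStirling.lean`, has the norm formula
`E(τ) = ‖γ(1/2 + iτ)‖ = ((τ² + 1/4)/2) π^{-1/4} ‖Γ(1/4 + iτ/2)‖`, vertical Stirling with an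
`O(1/|u|)` remainder, and part (i), the global bound `E(τ) ≤ C₀ (1 + |τ|)^{7/4} e^{−π|τ|/4}`). Here:

* `UniversalFactor.narrowEnvelope_weight` — part (ii): with `c₀ = (π/2)^{1/4}`, for `t ≥ 4` and
  `|u| ≤ t/2`, `|E(t+u) · t^{-7/4} e^{πt/4} − c₀ e^{−πu/4}| ≤ 4e³c₀ · e^{−πu/4} (1 + |u|)/t`.
  With `τ = t + u ∈ [t/2, 3t/2]` this is the identity
  `log(E(τ) t^{-7/4} e^{πt/4}) − log(c₀ e^{−πu/4}) = log(1 + 1/(4τ²)) + (7/4) log(τ/t) + R₁`,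
  `|R₁| ≤ 19/(32τ)` (Stirling at `1/4 + iτ/2`), the bounds `0 ≤ log(1 + 1/(4τ²)) ≤ 1/(2t)`,
  `|log(τ/t)| ≤ 2|u|/t` (`UniversalFactor.narrowEnvelope_log_corr`), and
  `|e^{a} − e^{b}| ≤ e^{b}|a − b|e^{|a − b|}` (`UniversalFactor.narrowEnvelope_abs_exp_sub_exp_le`).
* `UniversalFactor.stub_narrowEnvelope` — the registered stub, parts (i) ∧ (ii).

References: E. C. Titchmarsh, *The Theory of the Riemann Zeta-Function* (1986), §4.12 (4.12.2),
§7.2–7.4.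
-/

noncomputable section

-- D-0017: `Summit.<S>.<S>.…` is the designed namespace of a single-problem summit.
set_option linter.dupNamespace false

namespace Summit.RiemannHypothesis.RiemannHypothesis.Theorems

open MeasureTheory Set Filter Complex intervalIntegral
open scoped Real Topology
open Literature.NumberTheory.LFunctions
open Literature.Analysis.SpecialFunctions

/-! ## Part (ii): the envelope against the weight `t^{-7/4} e^{πt/4}` -/

/-- `|e^{a} − e^{b}| ≤ e^{b} · |a − b| e^{|a − b|}` (from `1 + y ≤ e^{y}`). [folklore] -/
theorem UniversalFactor.narrowEnvelope_abs_exp_sub_exp_le (a b : ℝ) :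
    |Real.exp a - Real.exp b| ≤ Real.exp b * (|a - b| * Real.exp |a - b|) := by
  have key : ∀ y : ℝ, |Real.exp y - 1| ≤ |y| * Real.exp |y| := by
    intro y
    rcases le_or_gt 0 y with hy | hy
    · have hy1 : 0 ≤ Real.exp y - 1 := by linarith [Real.add_one_le_exp y]
      rw [abs_of_nonneg hy, abs_of_nonneg hy1]
      have h := Real.add_one_le_exp (-y)
      have hpos := Real.exp_pos y
      have h2 : Real.exp y * (-y + 1) ≤ Real.exp y * Real.exp (-y) :=
        mul_le_mul_of_nonneg_left h hpos.le
      rw [← Real.exp_add, add_neg_cancel, Real.exp_zero] at h2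
      nlinarith
    · have hy1 : Real.exp y - 1 < 0 := by linarith [Real.exp_lt_one_iff.mpr hy]
      rw [abs_of_neg hy, abs_of_neg hy1]
      have h := Real.add_one_le_exp y
      have h1 : 1 ≤ Real.exp (-y) := Real.one_le_exp (by linarith)
      nlinarith
  have h : Real.exp a - Real.exp b = Real.exp b * (Real.exp (a - b) - 1) := by
    have : Real.exp a = Real.exp b * Real.exp (a - b) := by rw [← Real.exp_add]; ring_nf
    rw [this]; ring
  rw [h, abs_mul, abs_of_pos (Real.exp_pos b)]
  exact mul_le_mul_of_nonneg_left (key (a - b)) (Real.exp_pos b).le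

/-- The two logarithmic corrections of part (ii): for `t ≥ 4`, `|u| ≤ t/2` (so that
`τ = t + u ∈ [t/2, 3t/2]`), `|log(τ² + 1/4) − 2 log τ| ≤ 1/(2t)` and `|log τ − log t| ≤ 2|u|/t`
(`log y ≤ y − 1`). [folklore] -/
theorem UniversalFactor.narrowEnvelope_log_corr {t u : ℝ} (ht : 4 ≤ t) (hu : |u| ≤ t / 2) :
    |Real.log ((t + u) ^ 2 + 1 / 4) - 2 * Real.log (t + u)| ≤ 1 / (2 * t) ∧
      |Real.log (t + u) - Real.log t| ≤ 2 * |u| / t := by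
  have hut := abs_le.mp hu
  have ht0 : 0 < t := by linarith
  have htne : t ≠ 0 := ht0.ne'
  have hτt : t / 2 ≤ t + u := by linarith [hut.1]
  have hτ0 : 0 < t + u := by linarith
  have hτne : t + u ≠ 0 := hτ0.ne'
  constructor
  · have hq : Real.log ((t + u) ^ 2 + 1 / 4) - 2 * Real.log (t + u) =
        Real.log (((t + u) ^ 2 + 1 / 4) / (t + u) ^ 2) := by
      rw [Real.log_div (by positivity) (by positivity), Real.log_pow]; norm_num
    rw [hq]
    have hq1 : 1 ≤ ((t + u) ^ 2 + 1 / 4) / (t + u) ^ 2 := by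
      rw [le_div_iff₀ (by positivity)]; linarith
    have hlo : 0 ≤ Real.log (((t + u) ^ 2 + 1 / 4) / (t + u) ^ 2) := Real.log_nonneg hq1
    have hhi : Real.log (((t + u) ^ 2 + 1 / 4) / (t + u) ^ 2) ≤ 1 / (4 * (t + u) ^ 2) := by
      have := Real.log_le_sub_one_of_pos
        (by positivity : (0 : ℝ) < ((t + u) ^ 2 + 1 / 4) / (t + u) ^ 2)
      have e : ((t + u) ^ 2 + 1 / 4) / (t + u) ^ 2 - 1 = 1 / (4 * (t + u) ^ 2) := by
        field_simp
        ring
      linarith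
    have h3 : 1 / (4 * (t + u) ^ 2) ≤ 1 / (2 * t) :=
      div_le_div_of_nonneg_left zero_le_one (by positivity) (by nlinarith)
    rw [abs_of_nonneg hlo]
    linarith
  · have hhi : Real.log (t + u) - Real.log t ≤ u / t := by
      rw [← Real.log_div hτne htne]
      have := Real.log_le_sub_one_of_pos (by positivity : (0 : ℝ) < (t + u) / t)
      have e : (t + u) / t - 1 = u / t := by
        field_simp
        ring
      linarith
    have hlo : u / (t + u) ≤ Real.log (t + u) - Real.log t := by
      have hq' : Real.log (t + u) - Real.log t = -Real.log (t / (t + u)) := by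
        rw [Real.log_div htne hτne]; ring
      rw [hq']
      have := Real.log_le_sub_one_of_pos (by positivity : (0 : ℝ) < t / (t + u))
      have e : t / (t + u) - 1 = -(u / (t + u)) := by
        field_simp
        ring
      linarith
    have h1 : u / t ≤ 2 * |u| / t :=
      div_le_div_of_nonneg_right (by linarith [le_abs_self u, abs_nonneg u]) ht0.le
    have h2 : -(2 * |u| / t) ≤ u / (t + u) := by
      have e1 : -(u / (t + u)) ≤ |u| / (t + u) := by
        rw [← neg_div]; exact div_le_div_of_nonneg_right (neg_le_abs u) hτ0.le
      have e2 : |u| / (t + u) ≤ |u| / (t / 2) :=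
        div_le_div_of_nonneg_left (abs_nonneg u) (by positivity) hτt
      have e3 : |u| / (t / 2) = 2 * |u| / t := by
        rw [div_div_eq_mul_div]
        ring
      linarith
    rw [abs_le]; constructor <;> linarith

/-- **The envelope against the weight.** With `c₀ = (π/2)^{1/4}`: for `t ≥ 4` and `|u| ≤ t/2`,
`|E(t+u) · t^{-7/4} e^{πt/4} − c₀ e^{−πu/4}| ≤ 4e³c₀ · e^{−πu/4} (1 + |u|)/t`
(vertical Stirling at `1/4 + i(t+u)/2`: the logarithm of the quotient is
`log(1 + 1/(4τ²)) + (7/4) log(τ/t) + O(1/τ)`, `τ = t + u ∈ [t/2, 3t/2]`). [folklore] -/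
theorem UniversalFactor.narrowEnvelope_weight :
    ∃ c₀ C T₀ : ℝ, 0 < c₀ ∧ ∀ t : ℝ, T₀ ≤ t → ∀ u : ℝ, |u| ≤ t / 2 →
      |‖xiGammaFactor (1 / 2 + ((t + u : ℝ) : ℂ) * I)‖ * (t ^ (-(7 : ℝ) / 4) * Real.exp (π * t / 4)) -
          c₀ * Real.exp (-(π * u / 4))| ≤ C * Real.exp (-(π * u / 4)) * (1 + |u|) / t := by
  refine ⟨(π / 2) ^ (1 / 4 : ℝ), 4 * Real.exp 3 * (π / 2) ^ (1 / 4 : ℝ), 4, by positivity,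
    fun t ht u hu => ?_⟩
  obtain ⟨hP₁b, hP₂b⟩ := UniversalFactor.narrowEnvelope_log_corr ht hu
  have hut := abs_le.mp hu
  have ht0 : 0 < t := by linarith
  have hτt : t / 2 ≤ t + u := by linarith [hut.1]
  have hτ0 : 0 < t + u := by linarith
  -- Stirling at `1/4 + iτ/2`, `τ = t + u`
  have hy : 1 ≤ |(t + u) / 2| := by
    rw [abs_of_pos (by linarith : (0 : ℝ) < (t + u) / 2)]; linarith
  have hS := UniversalFactor.narrowEnvelope_stirling (x := 1 / 4) (u := (t + u) / 2)
    (by norm_num) hy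
  rw [abs_of_pos (by linarith : (0 : ℝ) < (t + u) / 2)] at hS
  rw [UniversalFactor.narrowEnvelope_norm_eq]
  generalize hG : ‖Complex.Gamma (((1 / 4 : ℝ) : ℂ) + (((t + u) / 2 : ℝ) : ℂ) * I)‖ = G at hS ⊢
  have hG0 : 0 < G := by
    rw [← hG]; exact norm_pos_iff.mpr (GammaVert.Gamma_ne_zero_of_pos (by norm_num) _)
  have hA0 : 0 < ((t + u) ^ 2 + 1 / 4) / 2 := by positivity
  -- the Stirling remainder `R₁`
  have hR₁b : |Real.log G - ((1 / 4 - 1 / 2) * Real.log ((t + u) / 2) - π * ((t + u) / 2) / 2 +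
      Real.log (2 * π) / 2)| ≤ (19 / 16) / t := by
    refine hS.trans ?_
    rw [div_le_div_iff₀ (by linarith : (0 : ℝ) < (t + u) / 2) ht0]
    linarith
  generalize hP₁ : Real.log ((t + u) ^ 2 + 1 / 4) - 2 * Real.log (t + u) = P₁ at hP₁b
  generalize hP₂ : Real.log (t + u) - Real.log t = P₂ at hP₂b
  generalize hR₁ : Real.log G - ((1 / 4 - 1 / 2) * Real.log ((t + u) / 2) -
    π * ((t + u) / 2) / 2 + Real.log (2 * π) / 2) = R₁ at hR₁b
  -- the exponent `D = P₁ + (7/4) P₂ + R₁` of the quotient and its bounds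
  have hDb : |P₁ + (7 / 4) * P₂ + R₁| ≤ (7 / 2) * (1 + |u|) / t := by
    obtain ⟨a1, a2⟩ := abs_le.mp hP₁b
    obtain ⟨b1, b2⟩ := abs_le.mp hP₂b
    obtain ⟨c1, c2⟩ := abs_le.mp hR₁b
    have e : (7 / 2) * (1 + |u|) / t = (7 / 2) * (1 / t) + (7 / 2) * (|u| / t) := by ring
    have e1 : 1 / (2 * t) = (1 / 2) * (1 / t) := by ring
    have e2 : 2 * |u| / t = 2 * (|u| / t) := by ring
    have e3 : (19 / 16) / t = (19 / 16) * (1 / t) := by ring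
    have hv : 0 ≤ 1 / t := by positivity
    rw [e1] at a1 a2
    rw [e2] at b1 b2
    rw [e3] at c1 c2
    rw [abs_le, e]
    constructor <;> linarith
  have hD3 : |P₁ + (7 / 4) * P₂ + R₁| ≤ 3 := by
    refine hDb.trans ?_
    rw [div_le_iff₀ ht0]
    linarith
  generalize hD : P₁ + (7 / 4) * P₂ + R₁ = D at hDb hD3
  -- the product and the main term as exponentials
  obtain ⟨B, hB⟩ : ∃ B : ℝ, B = Real.log (π / 2) * (1 / 4 : ℝ) + -(π * u / 4) := ⟨_, rfl⟩
  have hlog2π : Real.log (2 * π) = Real.log 2 + Real.log π :=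
    Real.log_mul two_ne_zero Real.pi_pos.ne'
  have hlogπ2 : Real.log (π / 2) = Real.log π - Real.log 2 :=
    Real.log_div Real.pi_pos.ne' two_ne_zero
  have hlogτ2 : Real.log ((t + u) / 2) = Real.log (t + u) - Real.log 2 :=
    Real.log_div hτ0.ne' two_ne_zero
  have hlogA : Real.log (((t + u) ^ 2 + 1 / 4) / 2) = Real.log ((t + u) ^ 2 + 1 / 4) - Real.log 2 :=
    Real.log_div (by positivity) two_ne_zero
  have hprod : ((t + u) ^ 2 + 1 / 4) / 2 * π ^ (-(1 / 4 : ℝ)) * G *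
      (t ^ (-(7 : ℝ) / 4) * Real.exp (π * t / 4)) = Real.exp (B + D) := by
    have e : B + D = Real.log (((t + u) ^ 2 + 1 / 4) / 2) + Real.log π * (-(1 / 4 : ℝ)) +
        Real.log G + (Real.log t * (-(7 : ℝ) / 4) + π * t / 4) := by
      rw [hB, ← hD, ← hP₁, ← hP₂, ← hR₁, hlogA, hlogτ2, hlog2π, hlogπ2]
      ring
    rw [e, Real.exp_add, Real.exp_add, Real.exp_add, Real.exp_add, Real.exp_log hA0,
      Real.exp_log hG0, Real.rpow_def_of_pos Real.pi_pos, Real.rpow_def_of_pos ht0]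
  have hc₀ : (π / 2) ^ (1 / 4 : ℝ) * Real.exp (-(π * u / 4)) = Real.exp B := by
    rw [hB, Real.exp_add, Real.rpow_def_of_pos (by positivity : (0 : ℝ) < π / 2)]
  rw [hprod, hc₀]
  -- `|e^{B+D} − e^{B}| ≤ e^{B} |D| e^{|D|} ≤ e^{B} · (7/2)(1+|u|)/t · e³`
  have hkey := UniversalFactor.narrowEnvelope_abs_exp_sub_exp_le (B + D) B
  rw [add_sub_cancel_left] at hkey
  have hexpD : |D| * Real.exp |D| ≤ (7 / 2) * (1 + |u|) / t * Real.exp 3 :=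
    mul_le_mul hDb (Real.exp_le_exp.mpr hD3) (Real.exp_pos _).le (by positivity)
  calc |Real.exp (B + D) - Real.exp B| ≤ Real.exp B * (|D| * Real.exp |D|) := hkey
    _ ≤ Real.exp B * ((7 / 2) * (1 + |u|) / t * Real.exp 3) :=
        mul_le_mul_of_nonneg_left hexpD (Real.exp_pos _).le
    _ ≤ Real.exp B * (4 * (1 + |u|) / t * Real.exp 3) := by
        apply mul_le_mul_of_nonneg_left _ (Real.exp_pos _).le
        apply mul_le_mul_of_nonneg_right _ (Real.exp_pos _).le
        apply div_le_div_of_nonneg_right _ ht0.le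
        linarith [abs_nonneg u]
    _ = 4 * Real.exp 3 * (π / 2) ^ (1 / 4 : ℝ) * Real.exp (-(π * u / 4)) * (1 + |u|) / t := by
        rw [← hc₀]; ring

/-! ## The registered stub -/

/-- **Stub P2 (the ξ-envelope on the critical line, Stirling).** With `E(τ) = ‖γ(1/2 + iτ)‖ =
((τ² + 1/4)/2) π^{-1/4} ‖Γ(1/4 + iτ/2)‖`: (i) the global bound `E(τ) ≤ C₀ (1+|τ|)^{7/4} e^{−π|τ|/4}`;
(ii) against the weight `w(t) = t^{-7/4} e^{πt/4}`, `E(t+u) w(t) = c₀ e^{−πu/4} (1 + O((1+|u|)/t))`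
uniformly for `|u| ≤ t/2` (`c₀ = (π/2)^{1/4}`; vertical Stirling formula, Titchmarsh (4.12.2)).
[folklore] -/
theorem UniversalFactor.stub_narrowEnvelope :
    (∃ C₀ : ℝ, ∀ τ : ℝ, ‖xiGammaFactor (1 / 2 + (τ : ℂ) * I)‖ ≤
        C₀ * (1 + |τ|) ^ ((7 : ℝ) / 4) * Real.exp (-(π * |τ| / 4))) ∧
      (∃ c₀ C T₀ : ℝ, 0 < c₀ ∧ ∀ t : ℝ, T₀ ≤ t → ∀ u : ℝ, |u| ≤ t / 2 →
        |‖xiGammaFactor (1 / 2 + ((t + u : ℝ) : ℂ) * I)‖ * (t ^ (-(7 : ℝ) / 4) * Real.exp (π * t / 4)) -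
            c₀ * Real.exp (-(π * u / 4))| ≤ C * Real.exp (-(π * u / 4)) * (1 + |u|) / t) :=
  ⟨UniversalFactor.narrowEnvelope_global, UniversalFactor.narrowEnvelope_weight⟩

end Summit.RiemannHypothesis.RiemannHypothesis.Theorems
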